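import Summits.BirchSwinnertonDyer.Rank1Residual.Additive.TwistPartnerForcedCertificateJoin
import HarnessLib

/-!
# The λ-certificate AT THE PLUS-SYMBOL BOUND: non-integral rows (X3♯(G-ord), rational `p`-isogeny)
# — `λ ≤ k` from ONE finite Riemann sum attaining the bound `p^c` of `E`'s plus symbols
# (cell `b2b-bsdres`, sub-cell additive-p2 = X3♯(G-ord) / X4♯(G-ord), gen 24; sequel of
# `TwistPartnerForcedCertificateJoin.lean` and of `TameBranchKatoDivisibility.lean` §3–§4)

HONEST FRAMING (cell `b2b-bsdres`, run/shared/lean/b2b/bsd-rank1-residual/, verbatim in every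
file): the goal of the cell is to DELETE the COMBINATION-SHAPED residual classes of the
Birch–Swinnerton-Dyer formula for ALL analytic-rank `≤ 1` elliptic curves over `ℚ` — "full BSD
formula for every rank `≤ 1` curve in class `C`" assembled STRICTLY from published theorems — so
that the rank-`≤ 1` remainder becomes exactly the CONSTRUCTION-SHAPED classes, which are TYPED
(missing-input `Prop`s), NOT attempted. This is not "finishing BSD". Sub-cell additive-p2: the
classes X3♯(G-ord) / X4♯(G-ord) are CONSTRUCTION-SHAPED and stay so; labels / RESIDUAL-MAP marks
UNCHANGED; nothing is booked. THEOREMS ONLY (no definition, no named fact, no conjecture node);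
every unproved input (the typed Kato half `TameBranchRatDvdAt` or Delbourgo 2002 (A), (A_M), (C) =
A175/A227, GZK, boundedness of the forced partner, the plus-symbol bound `p^c`, the finite equality
`‖RS k n‖ = p^c`) is an explicit hypothesis (referee-1 rule R1); instrument Riemann sums are EVIDENCE.

## Why

`TwistPartnerForcedCertificateJoin.lean` certifies `λ ≤ k` from `‖RS k n‖ = 1` under
`PlusSymbolsPIntegralAt W p` — a THEOREM on irreducible rows (X4) and FALSE on rows with a rational
`p`-isogeny (census: the 5 failures among 142 typeG rows are exactly the `p`-isogeny rows), i.e. on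
X3♯(G-ord) (`ClassX3 = Red ∧ Addv`). There the plus symbols satisfy only `‖[r]⁺_f‖_p ≤ p^c` with
`c ≥ 1` (Manin–Drinfeld: a common denominator; `c` computable per pair), the E-normalised tame branch
inherits `‖[Tʲ]B‖ ≤ p^c` (integrality transfer), and a RATIONAL divisibility `L_p^{alg} ∣ p^k·B` bounds
`λ` by the FIRST index at which `B` ATTAINS its bound: `ι g = p^k·B`, `‖[Tʲ]B‖ ≤ p^c`, `‖[Tⁿ]B‖ = p^c`
⟹ `λ(fE) ≤ n` for every `fE ∣ g` (rescale `B' = p^c·B ∈ Λ`, unit coefficient at `n`;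
`lam_le_of_dvd_of_iota_eq_C_pow_mul`). So the per-pair certificate on a non-integral row is
`‖RS k n‖_p = p^c` — the Riemann sum ATTAINS the plus-symbol bound — not `= 1`. (A Riemann sum of norm
`1 < p^c` certifies `‖[T^k]B‖ = 1` but NOT `λ ≤ k`: the content of `B` may sit at a later index. NB the
denominators of the forced partner's values in `ℚ(ζ_e)` seen by an engine are NOT the bound: `(ã/p)ʲ`
has denominators at the conjugate prime only; `c` is `−min_r v_p [r]⁺_f`, read `p`-adically — gen 24
E-FORCED-6 measures it per row.)

## What

* §1 `lam_le_of_dvd_of_iota_eq_C_pow_mul_of_norm_le_pow` (Λ-algebra), §2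
  `charLamLeAt_of_tameBranchRatDvdAt_of_norm_le_pow_of_norm_coeff_eq_pow` (the discharge of
  n1011-p01's `CharLamLeAt W p n` from the typed Kato half and ONE tame branch bounded by `p^c`
  attaining `p^c` at index `n`);
* §3 (forced partner, Riemann sums `RS` via `hRS` as in `TwistPartnerForcedCertificate.lean`):
  `IsTameBranchOf.norm_coeff_eq_pow_of_forcedRiemannSum` (`‖[r]⁺_f‖ ≤ p^c`, `k < p`, `n ≥ 1`,
  `‖RS k n‖ = p^c ⟹ ‖[T^k]B‖ = p^c`), the JOIN
  `charLamLeAt_of_tameBranchRatDvdAt_of_forcedRiemannSum_of_bound` on the X4-3 locus (defect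
  `3, 4, 6`; no `PlusSymbolsPIntegralAt`), its rank-one Schneider consequence, and the X3♯(G-ord)
  class form `ClassX3Gord.exists_schneider_rankOne_of_thmC_of_forcedRiemannSum_of_bound` from
  Delbourgo 2002 (A), (B), (C) + GZK + boundedness of the forced partner + the bound `p^c` + ONE sum.
With `c = 0` these are the statements of the Join file. Nothing booked.

References: D. Delbourgo, J. Number Theory 95 (2002) Thm. (A)–(C) p. 40 [Delbourgo2002];
L. Washington, GTM 83 §7.1 [Washington1997]; B. Mazur, J. Tate, J. Teitelbaum, Invent. Math. 84 (1986)
§I.10–I.14 [MazurTateTeitelbaum1986Invent]; W. Stein, C. Wuthrich, Math. Comp. 82 (2013) §3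
[SteinWuthrich2013]; Ju. I. Manin, Izv. 36 (1972) Cor. 3.6 [Manin1972]; R. Greenberg, V. Vatsal,
Invent. Math. 142 (2000) §3 (μ on `p`-isogeny rows) [GreenbergVatsal2000].
-/

noncomputable section

open scoped Classical MatrixGroups ModularForm NumberField

open CongruenceSubgroup WeierstrassCurve NumberField Literature.NumberTheory.EllipticCurves
  Literature.NumberTheory.EllipticCurves.ModularForms
  Literature.NumberTheory.EllipticCurves.Rank1Residual
  Literature.NumberTheory.EllipticCurves.Rank1Residual.Typed
  Literature.NumberTheory.EllipticCurves.Delbourgo2002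
  Summit.BirchSwinnertonDyer.Rank1Residual.X1.MuLambda
  Summit.BirchSwinnertonDyer.Rank1Residual.X11a.LambdaNorm

namespace Summit.BirchSwinnertonDyer.Rank1Residual.Additive

/-! ### §1 Λ-algebra: a rational divisibility by a series ATTAINING its bound at index `n` gives `λ ≤ n` -/

section Lambda

variable {p : ℕ} [hp : Fact p.Prime]

/-- **`λ ≤ n` at the bound.** If `fE ∣ g` in `Λ = ℤ_p⟦T⟧`, `ι g = p^k · B` with `‖[Tʲ]B‖_p ≤ p^c` for
all `j` and `‖[Tⁿ]B‖_p = p^c`, then `λ(fE) ≤ n`: `B' = p^c·B` is `p`-integral with a unit coefficient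
at `n` and `ι(p^c g) = p^k·B'`, so `lam_le_of_dvd_of_iota_eq_C_pow_mul` applies to `fE ∣ p^c g`
(`λ` is blind to `p`-powers). [cite: Washington1997, §7.1] -/
theorem lam_le_of_dvd_of_iota_eq_C_pow_mul_of_norm_le_pow {fE g : IwasawaAlgebra p} (hdvd : fE ∣ g)
    {k n c : ℕ} {B : PowerSeries ℚ_[p]}
    (hι : iwasawaToPowerSeries p g = PowerSeries.C ((p : ℚ_[p]) ^ k) * B)
    (hbd : ∀ j : ℕ, ‖PowerSeries.coeff j B‖ ≤ (p : ℝ) ^ c)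
    (hn : ‖PowerSeries.coeff n B‖ = (p : ℝ) ^ c) : lam fE ≤ n := by
  have hp0 : (0 : ℝ) < (p : ℝ) ^ c := pow_pos (by exact_mod_cast hp.out.pos) c
  have hpc : ‖((p : ℚ_[p]) ^ c)‖ = ((p : ℝ) ^ c)⁻¹ := by
    rw [norm_pow, Padic.norm_p, inv_pow]
  set B' : PowerSeries ℚ_[p] := PowerSeries.C ((p : ℚ_[p]) ^ c) * B with hB'
  have hcoeff : ∀ j : ℕ, ‖PowerSeries.coeff j B'‖ = ((p : ℝ) ^ c)⁻¹ * ‖PowerSeries.coeff j B‖ := by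
    intro j
    rw [hB', PowerSeries.coeff_C_mul, norm_mul, hpc]
  have hint' : ∀ j : ℕ, ‖PowerSeries.coeff j B'‖ ≤ 1 := fun j ↦ by
    rw [hcoeff, inv_mul_le_iff₀ hp0, mul_one]
    exact hbd j
  have hn' : ‖PowerSeries.coeff n B'‖ = 1 := by
    rw [hcoeff, hn, inv_mul_cancel₀ hp0.ne']
  have hι' : iwasawaToPowerSeries p (PowerSeries.C ((p : ℤ_[p]) ^ c) * g) =
      PowerSeries.C ((p : ℚ_[p]) ^ k) * B' := by
    rw [map_mul, Literature.NumberTheory.EllipticCurves.iwasawaToPowerSeries_C_natCast_pow p, hι, hB']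
    ring
  exact lam_le_of_dvd_of_iota_eq_C_pow_mul (Dvd.dvd.mul_left hdvd _) hι' hint' hn'

end Lambda

/-! ### §2 The discharge of `CharLamLeAt W p n` from a tame branch attaining its bound at `n` -/

section Discharge

variable {W : WeierstrassCurve ℚ} [W.IsElliptic] [W.IsGloballyMinimal] {p : ℕ} [hp : Fact p.Prime]

/-- **`CharLamLeAt W p n` from the typed Kato half and ONE tame branch bounded by `p^c` that ATTAINS
`p^c` at index `n`** — the non-integral generalisation (`c ≥ 1`: rows with a rational `p`-isogeny,
where `PlusSymbolsPIntegralAt` fails) of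
`charLamLeAt_of_tameBranchRatDvdAt_of_integral_of_norm_coeff_eq_one` (`c = 0`).
[cite: Delbourgo2002, Theorem (C) (p. 40)] [cite: Washington1997, §7.1] -/
theorem charLamLeAt_of_tameBranchRatDvdAt_of_norm_le_pow_of_norm_coeff_eq_pow
    (hT : TameBranchRatDvdAt W p)
    {N : ℕ} [NeZero N] {f : CuspForm (Gamma0 N) 2} {ε : DirichletCharacter ℂ_[p] p} {α : ℚ_[p]}
    {B : PowerSeries ℚ_[p]}
    (hp2 : p ≠ 2) (hadd : Addv W p) (hloc : PotMult W p ∨ TypeGOrd W p)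
    (hf : IsNewformOf W f) (hε : orderOf ε = tameDefect W p) (hα : ‖α‖ = 1)
    (hB : IsTameBranchOf f p ε α B) {c : ℕ} (hbd : ∀ j : ℕ, ‖PowerSeries.coeff j B‖ ≤ (p : ℝ) ^ c)
    {n : ℕ} (hn : ‖PowerSeries.coeff n B‖ = (p : ℝ) ^ c) : CharLamLeAt W p n := by
  intro κ γ hκ hγ hcv D fE hchar
  obtain ⟨-, g, hg, k, hι⟩ := hT ε α B hp2 hadd hloc hκ hγ hcv hf hε hα hB D
  rw [hchar] at hg
  exact lam_le_of_dvd_of_iota_eq_C_pow_mul_of_norm_le_pow (Ideal.mem_span_singleton.mp hg) hι hbd hn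

end Discharge

/-! ### §3 The forced partner: the certificate AT THE BOUND, the JOIN, the X3♯(G-ord) class form -/

section Forced

variable {W : WeierstrassCurve ℚ} [W.IsElliptic] [W.IsGloballyMinimal] {p : ℕ} [hp : Fact p.Prime]
  {N : ℕ} [NeZero N] {f : CuspForm (Gamma0 N) 2} {χ : MulChar (ZMod p) ℚ_[p]} {ã : ℚ_[p]}
  {RS : ℕ → ℕ → ℚ_[p]}
  (hRS : ∀ k n : ℕ, RS k n =
      ∑ᶠ ξ : rootsOfUnity (Literature.NumberTheory.EllipticCurves.torsionOrder p) ℤ_[p],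
        ∑ s : ZMod (p ^ n),
        twistPartnerMeasure χ
            (TwistPartner.forced χ (fun r ↦ ((ratPlusSymbol f r : ℚ) : ℚ_[p])) ã) ã
            ((ratPlusSymbol f 0 : ℚ) : ℚ_[p]) (n + cyclotomicExponent p)
            (PadicInt.toZModPow (n + cyclotomicExponent p) ((ξ : ℤ_[p]ˣ) : ℤ_[p]) *
              (cyclotomicGenerator p : ZMod (p ^ (n + cyclotomicExponent p))) ^ s.val) *
          ((s.val.choose k : ℕ) : ℚ_[p]))

include hRS

/-- **The certificate AT THE BOUND.** `χ ≠ 1`, `‖ã‖ = 1`, `U_p[·]⁺_f = 0`, the forced partner bounded,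
the plus symbols bounded by `p^c` (`‖[r]⁺_f‖_p ≤ p^c`), `k < p`, `n ≥ 1`: if the Riemann sum has
`‖RS k n‖_p = p^c` then `‖[T^k]B‖_p = p^c` for every `B` with `IsTameBranchOf f p (ι∘χ) ã B`
(the isosceles certificate with `C = p^c`: `p^c·p⁻ⁿ < p^c`). [cite: SteinWuthrich2013, §3]
[cite: MazurTateTeitelbaum1986Invent, §I.10–I.14] -/
theorem IsTameBranchOf.norm_coeff_eq_pow_of_forcedRiemannSum (hχ : χ ≠ 1) (hã : ‖ã‖ = 1)
    (hU0 : ∀ s, ∑ d : ZMod p, ratPlusSymbol f (s + (d.val : ℚ) / p) = 0) {C₀ : ℝ}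
    (hC₀ : ∀ s, ‖TwistPartner.forced χ (fun r ↦ ((ratPlusSymbol f r : ℚ) : ℚ_[p])) ã s‖ ≤ C₀)
    {B : PowerSeries ℚ_[p]} (hB : IsTameBranchOf f p (χ.ringHomComp (algebraMap ℚ_[p] ℂ_[p])) ã B)
    {c : ℕ} (hc : ∀ r : ℚ, ‖((ratPlusSymbol f r : ℚ) : ℚ_[p])‖ ≤ (p : ℝ) ^ c) {k n : ℕ} (hk : k < p)
    (hn : 1 ≤ n) (heq : ‖RS k n‖ = (p : ℝ) ^ c) : ‖PowerSeries.coeff k B‖ = (p : ℝ) ^ c := by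
  have hp1 : (1 : ℝ) < p := by exact_mod_cast hp.out.one_lt
  have hpc : (0 : ℝ) < (p : ℝ) ^ c := pow_pos (by exact_mod_cast hp.out.pos) c
  have hfac : ‖((k.factorial : ℕ) : ℚ_[p])‖ = 1 := by
    have hnd : ¬ (p : ℤ) ∣ (k.factorial : ℤ) := by
      intro h
      have h' : p ∣ k.factorial := by exact_mod_cast h
      exact (Nat.not_le.mpr hk) (hp.out.dvd_factorial.mp h')
    rw [← Int.cast_natCast]
    exact le_antisymm (Padic.norm_int_le_one _)
      (not_lt.mp fun h ↦ hnd (Padic.norm_intCast_lt_one_iff.mp h))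
  have hlt : (p : ℝ) ^ c / ‖((k.factorial : ℕ) : ℚ_[p])‖ * (p : ℝ) ^ (-n : ℤ) < ‖RS k n‖ := by
    rw [hfac, div_one, heq]
    calc (p : ℝ) ^ c * (p : ℝ) ^ (-n : ℤ) < (p : ℝ) ^ c * (p : ℝ) ^ (0 : ℤ) :=
          mul_lt_mul_of_pos_left (zpow_lt_zpow_right₀ hp1 (by omega)) hpc
      _ = (p : ℝ) ^ c := by rw [zpow_zero, mul_one]
  rw [(hB.norm_coeff_eq_forcedRiemannSum_of_lt hRS hχ hã hU0 hC₀ hc hlt).1, heq]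

/-- **THE JOIN AT THE BOUND (no integrality hypothesis).** On the X4-3 locus (`p ≥ 5`, `E = W`
additive at `p`, `SubGord`, `e ∈ {3,4,6}`), for a newform `f` of `E`, `χ = ω^{t(E,p)}`, a unit `ã`:
typed Kato half + the plus-symbol bound `‖[r]⁺_f‖_p ≤ p^c` + boundedness of the forced partner + ONE
Riemann sum with `‖RS k n‖_p = p^c` (`k < p`, `n ≥ 1`) ⟹ `CharLamLeAt W p k`. For `c = 0` this is
`charLamLeAt_of_tameBranchRatDvdAt_of_forcedRiemannSum`; for `c ≥ 1` it is the certificate usable on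
rows with a rational `p`-isogeny. [cite: Delbourgo2002, Theorem (C) (p. 40)] [cite: Washington1997, §7.1]
[cite: SteinWuthrich2013, §3] -/
theorem charLamLeAt_of_tameBranchRatDvdAt_of_forcedRiemannSum_of_bound (hT : TameBranchRatDvdAt W p)
    (h5 : 5 ≤ p) (hadd : Addv W p) (hG : SubGord W p)
    (he : semistabilityIndex W p ∈ ({3, 4, 6} : Finset ℕ)) (hf : IsNewformOf W f)
    (hχ : CensusX43.IsTeichmullerPow χ (CensusX43.ordinaryTeichmullerExponent W p)) (hã : ‖ã‖ = 1)
    {C₀ : ℝ}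
    (hC₀ : ∀ s, ‖TwistPartner.forced χ (fun r ↦ ((ratPlusSymbol f r : ℚ) : ℚ_[p])) ã s‖ ≤ C₀)
    {c : ℕ} (hc : ∀ r : ℚ, ‖((ratPlusSymbol f r : ℚ) : ℚ_[p])‖ ≤ (p : ℝ) ^ c)
    {k n : ℕ} (hk : k < p) (hn : 1 ≤ n) (heq : ‖RS k n‖ = (p : ℝ) ^ c) : CharLamLeAt W p k := by
  have hne : χ ≠ 1 := CensusX43.ne_one_of_isTeichmullerPow hχ
    (CensusX43.not_dvd_ordinaryTeichmullerExponent W p h5 he hG.2.2)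
  obtain ⟨B, hord, hB, hint, -⟩ :=
    exists_isTameBranchOf_forcedRiemannSum_of_isTeichmullerPow hRS h5 hadd hG he hf hχ hã hC₀
  have hp2 : p ≠ 2 := by omega
  have hne2 : semistabilityIndex W p ≠ 2 := by
    simp only [Finset.mem_insert, Finset.mem_singleton] at he
    omega
  have hGord : TypeGOrd W p :=
    (typeGOrd_iff_typeG_of_semistabilityIndex_ne_two W p h5 hadd hne2).mpr
      ((subGord_iff_typeG_of_addv W p hp2 hadd).mp hG)
  have hbd : ∀ j : ℕ, ‖PowerSeries.coeff j B‖ ≤ (p : ℝ) ^ c := hint _ hc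
  have hk' : ‖PowerSeries.coeff k B‖ = (p : ℝ) ^ c :=
    hB.norm_coeff_eq_pow_of_forcedRiemannSum hRS hne hã
      (sum_ratPlusSymbol_add_div_eq_zero_of_addv W hf hadd) hC₀ hc hk hn heq
  exact charLamLeAt_of_tameBranchRatDvdAt_of_norm_le_pow_of_norm_coeff_eq_pow hT hp2 hadd (Or.inr hGord)
    hf hord hã hB hbd hk'

/-- **X4-3 locus, `ord_{s=1} L(E,s) = 1`, non-CM: Schneider for Delbourgo's datum from the certificate
AT THE BOUND** (typed Kato half; `‖[r]⁺_f‖ ≤ p^c`; forced partner bounded; `‖RS 1 n‖ = p^c`, `n ≥ 1`;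
A175; GZK): `Reg_p(E,Dh) ≠ 0` for every height datum with the (B)-clauses, and one exists.
[cite: Delbourgo2002, Theorem (A), (B), (C) (p. 40)] [cite: SteinWuthrich2013, §3] -/
theorem exists_schneider_rankOne_of_tameBranchRatDvdAt_of_forcedRiemannSum_of_bound
    (hDel : Delbourgo2002.mainTheorem) (hGZK : rank_eq_analyticRank_of_analyticRank_le_one)
    (hT : TameBranchRatDvdAt W p) (h5 : 5 ≤ p) (hcm : ¬ W.HasCM) (hadd : Addv W p) (hG : SubGord W p)
    (he : semistabilityIndex W p ∈ ({3, 4, 6} : Finset ℕ)) (hr : W.analyticRank = 1)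
    (hf : IsNewformOf W f)
    (hχ : CensusX43.IsTeichmullerPow χ (CensusX43.ordinaryTeichmullerExponent W p)) (hã : ‖ã‖ = 1)
    {C₀ : ℝ}
    (hC₀ : ∀ s, ‖TwistPartner.forced χ (fun r ↦ ((ratPlusSymbol f r : ℚ) : ℚ_[p])) ã s‖ ≤ C₀)
    {c : ℕ} (hc : ∀ r : ℚ, ‖((ratPlusSymbol f r : ℚ) : ℚ_[p])‖ ≤ (p : ℝ) ^ c)
    {n : ℕ} (hn : 1 ≤ n) (heq : ‖RS 1 n‖ = (p : ℝ) ^ c) :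
    (∀ Dh : PAdicHeightData W p, LeadingTermClauses W p Dh → SchneiderConjecture Dh) ∧
      ∃ Dh : PAdicHeightData W p, LeadingTermClauses W p Dh ∧ SchneiderConjecture Dh := by
  have hp2 : p ≠ 2 := by omega
  have hne2 : semistabilityIndex W p ≠ 2 := by
    simp only [Finset.mem_insert, Finset.mem_singleton] at he
    omega
  have hGord : TypeGOrd W p :=
    (typeGOrd_iff_typeG_of_semistabilityIndex_ne_two W p h5 hadd hne2).mpr
      ((subGord_iff_typeG_of_addv W p hp2 hadd).mp hG)
  obtain ⟨hmw, -⟩ := hGZK W (by rw [hr])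
  have hr1 : W.mordellWeilRank = 1 := by rw [hmw, hr]
  have hlam : CharLamLeAt W p W.mordellWeilRank := by
    rw [hr1]
    exact charLamLeAt_of_tameBranchRatDvdAt_of_forcedRiemannSum_of_bound hRS hT h5 hadd hG he hf hχ hã
      hC₀ hc (by omega) hn heq
  have hA : ∀ (κ : ZpExtension ℚ p) (γ : Field.absoluteGaloisGroup ℚ),
      κ.IsCyclotomic → κ.IsTopGenerator γ → ∀ D : W.SelmerDualData κ γ, D.IsTorsion :=
    fun _ _ hκ hγ D ↦ Delbourgo2002.mainTheorem.isTorsion hDel h5 hcm hadd hGord hκ hγ D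
  have hS : ∀ Dh : PAdicHeightData W p, LeadingTermClauses W p Dh → SchneiderConjecture Dh :=
    fun Dh hBcl ↦ (schneider_and_finite_of_charLamLe W p hBcl hA hlam).1
  obtain ⟨Dh, hBcl⟩ := Delbourgo2002.mainTheorem.exists_leadingTermClauses hDel h5 hcm hadd hGord
  exact ⟨hS, Dh, hBcl, hS Dh hBcl⟩

/-- **X3♯(G-ord), defect 3, 4, 6, `ord_{s=1} L(E,s) = 1`, `p ≥ 5`, non-CM: SCHNEIDER for Delbourgo's
datum from PRINTED facts + three per-pair inputs** — Delbourgo 2002 (A), (B), (C) (A175, A227) and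
GZK; boundedness of the forced partner (Manin–Drinfeld for `f̃`), the plus-symbol bound `p^c`
(Manin–Drinfeld for `f_E`; `c ≥ 1` on these reducible rows), and ONE Riemann sum with
`‖RS 1 n‖_p = p^c` (`n ≥ 1`). `SubGord` is automatic (`subGord_iff_typeG_of_addv`). The X3 twin of
`ClassX4Gord.exists_schneider_rankOne_of_thmC_of_forcedRiemannSum`; nothing booked.
[cite: Delbourgo2002, Theorem (A), (B), (C) (p. 40)] [cite: Manin1972, Cor. 3.6] [cite: SteinWuthrich2013, §3] -/
theorem ClassX3Gord.exists_schneider_rankOne_of_thmC_of_forcedRiemannSum_of_bound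
    (hC : Delbourgo2002.thmC_charIdeal_dvd_tameBranch) (hDel : Delbourgo2002.mainTheorem)
    (hDelM : Delbourgo2002.mainTheorem_potMult) (hGZK : rank_eq_analyticRank_of_analyticRank_le_one)
    (hX : ClassX3Gord W p) (h5 : 5 ≤ p) (hcm : ¬ W.HasCM)
    (he : semistabilityIndex W p ∈ ({3, 4, 6} : Finset ℕ)) (hr : W.analyticRank = 1)
    (hf : IsNewformOf W f)
    (hχ : CensusX43.IsTeichmullerPow χ (CensusX43.ordinaryTeichmullerExponent W p)) (hã : ‖ã‖ = 1)
    {C₀ : ℝ}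
    (hC₀ : ∀ s, ‖TwistPartner.forced χ (fun r ↦ ((ratPlusSymbol f r : ℚ) : ℚ_[p])) ã s‖ ≤ C₀)
    {c : ℕ} (hc : ∀ r : ℚ, ‖((ratPlusSymbol f r : ℚ) : ℚ_[p])‖ ≤ (p : ℝ) ^ c)
    {n : ℕ} (hn : 1 ≤ n) (heq : ‖RS 1 n‖ = (p : ℝ) ^ c) :
    (∀ Dh : PAdicHeightData W p, LeadingTermClauses W p Dh → SchneiderConjecture Dh) ∧
      ∃ Dh : PAdicHeightData W p, LeadingTermClauses W p Dh ∧ SchneiderConjecture Dh :=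
  have hadd : Addv W p := hX.addv
  have hG : SubGord W p := (subGord_iff_typeG_of_addv W p (by omega) hadd).mpr hX.typeGOrd.typeG
  Additive.exists_schneider_rankOne_of_tameBranchRatDvdAt_of_forcedRiemannSum_of_bound hRS hDel hGZK
    (tameBranchRatDvdAt_of_thmC hC hDel hDelM h5 hcm) h5 hcm hadd hG he hr hf hχ hã hC₀ hc hn heq

/-- **X4♯(G-ord) form of the same statement** (the bound `p^c` kept as a hypothesis: with `c = 0` it is
`PlusSymbolsPIntegralAt`, a theorem there — `TwistPartnerForcedCertificateClassX4.lean`; stated for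
uniformity of the census join across X3/X4). [cite: Delbourgo2002, Theorem (A), (B), (C) (p. 40)] -/
theorem ClassX4Gord.exists_schneider_rankOne_of_thmC_of_forcedRiemannSum_of_bound
    (hC : Delbourgo2002.thmC_charIdeal_dvd_tameBranch) (hDel : Delbourgo2002.mainTheorem)
    (hDelM : Delbourgo2002.mainTheorem_potMult) (hGZK : rank_eq_analyticRank_of_analyticRank_le_one)
    (hX : ClassX4Gord W p) (h5 : 5 ≤ p) (hcm : ¬ W.HasCM)
    (he : semistabilityIndex W p ∈ ({3, 4, 6} : Finset ℕ)) (hr : W.analyticRank = 1)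
    (hf : IsNewformOf W f)
    (hχ : CensusX43.IsTeichmullerPow χ (CensusX43.ordinaryTeichmullerExponent W p)) (hã : ‖ã‖ = 1)
    {C₀ : ℝ}
    (hC₀ : ∀ s, ‖TwistPartner.forced χ (fun r ↦ ((ratPlusSymbol f r : ℚ) : ℚ_[p])) ã s‖ ≤ C₀)
    {c : ℕ} (hc : ∀ r : ℚ, ‖((ratPlusSymbol f r : ℚ) : ℚ_[p])‖ ≤ (p : ℝ) ^ c)
    {n : ℕ} (hn : 1 ≤ n) (heq : ‖RS 1 n‖ = (p : ℝ) ^ c) :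
    (∀ Dh : PAdicHeightData W p, LeadingTermClauses W p Dh → SchneiderConjecture Dh) ∧
      ∃ Dh : PAdicHeightData W p, LeadingTermClauses W p Dh ∧ SchneiderConjecture Dh :=
  have hadd : Addv W p := hX.addv.2
  have hG : SubGord W p := (subGord_iff_typeG_of_addv W p (by omega) hadd).mpr hX.typeGOrd.typeG
  Additive.exists_schneider_rankOne_of_tameBranchRatDvdAt_of_forcedRiemannSum_of_bound hRS hDel hGZK
    (tameBranchRatDvdAt_of_thmC hC hDel hDelM h5 hcm) h5 hcm hadd hG he hr hf hχ hã hC₀ hc hn heq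

end Forced

end Summit.BirchSwinnertonDyer.Rank1Residual.Additive

end
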